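import Summits.CriticalPhenomena.PercolationContinuityZ3.Theorems.FK.PressureEdgeDensity
import Summits.CriticalPhenomena.PercolationContinuityZ3.Theorems.FK.FreeWiredCoincidence
import Summits.CriticalPhenomena.PercolationContinuityZ3.Theorems.FK.UniquenessCriticalFKIsing
import HarnessLib

/-!
# FK-continuity cell, FO-10a: the mean edge density of the box measures with an ARBITRARY wired boundary class
# `B_N ⊆ ∂Λ_N` — Grimmett 2006, (4.74)–(4.76) (`dG^ξ_Λ/dπ → dG/dπ` off `𝒟_q`) for every such boundary condition

Registered R104 (cell INBOX l.7098, 2026-08-24); registry row FO-10a-g340; label BCW-B (coordinator fk-4 g217).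
Cell `fk-continuity` (bschramm), row FO-10a (domain-Markov + boundary-condition comparison layer over FO-06); support file
for the FK-continuity transplant (`--supports stmt-CriticalPhenomena-4575`); builds on p205010 (kernel theorem, internal
audit signed; external expert review pending). Pure proofs; no definitions, no named facts, no sorries; general `d`.
UNCONDITIONAL finite- and infinite-volume structure; it decides nothing about FH / TP_FK / the value of `p_c(q)`.

Grimmett 2006, proof of Thm. (4.63): the `π`-derivative of the finite-volume pressure with boundary condition `ξ` is the mean
number of open edges `|E_Λ|⁻¹ φ^ξ_{Λ,p,q}(|η|)` ((4.73)); by convexity it converges to `dG/dπ` off the countable set `𝒟_q`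
((4.74)), and the sandwich (4.75) between the free and wired densities identifies the limit `h⁰ = h¹` ((4.76)). The tree has
the two extreme cases as limits `|Λ_N|⁻¹ E^b_{Λ_N}|ω| → d · h^b(p,q)` (FO-10a `PressureEdgeDensity`, row FO-10a-g338d). Here,
for every sequence of ONE-CLASS boundary wirings `B_N ⊆ ∂Λ_N` of the boxes `Λ_N = [-N,N]^d` (`0 ≤ p ≤ 1`, `q ≥ 1`, `e₀` any
lattice edge, `h⁰ = freeEdgeDensity`, `h¹ = wiredEdgeDensity`), WITHOUT convexity — directly from the monotonicity of
`rcMeasure G p q B` in the wired set `B` (Literature `rcMeasure_real_mono_wired_of_isUpperSet`):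

* `sum_boxFreeEdgeProb_le_sum_rcMeasure_real_eOpen` / `sum_rcMeasure_real_eOpen_le_sum_boxWiredEdgeProb` — the termwise
  sandwich `∑_e φ⁰_{Λ_N}(J_e) ≤ ∑_e φ^B_{Λ_N}(J_e) ≤ ∑_e φ¹_{Λ_N}(J_e)` ((4.75));
* **`le_liminf_rcExpect_card_div_card_box`**, **`limsup_rcExpect_card_div_card_box_le`** —
  `d · h⁰(p,q) ≤ liminf_N |Λ_N|⁻¹ E^{B_N}_{Λ_N,p,q}|ω| ≤ limsup_N |Λ_N|⁻¹ E^{B_N}_{Λ_N,p,q}|ω| ≤ d · h¹(p,q)`;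
* **`tendsto_rcExpect_card_div_card_box_of_edgeDensity_eq`** — (4.74)/(4.76): at every `p` with `h⁰(p,q) = h¹(p,q)`
  (`p ∉ 𝒟_q`, Thm. (4.63)), `|Λ_N|⁻¹ E^{B_N}_{Λ_N,p,q}|ω| → d · h(p,q)` for EVERY sequence of wirings; the same under
  `φ⁰_{p,q} = φ¹_{p,q}` (`…_of_rcLimit_eq`, FO-07b `FreeWiredCoincidence`); and **at the critical point of the FK–Ising model,
  `d ≥ 3`** (`tendsto_rcExpect_card_div_card_box_rcCriticalProb_two`: no boundary sensitivity of the energy density at `β_c`,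
  from `h⁰(p_c(2),2) = h¹(p_c(2),2)`, FO-10a `UniquenessCriticalFKIsing`, Aizenman–Duminil-Copin–Sidoravicius 2015).

Honest framing: infinite-volume averaging for the boundary conditions expressible in the tree (ONE wired class); no statement
about `p_c(q)`; the `q = 2` clause is a COROLLARY of the in-tree ADS chain; NOT a binder discharge, NOT `_r4`. Companion
file: `BoundaryWiringSandwich.lean` (the sandwich on events and uniqueness iff boundary-wiring insensitivity).

## References

* G. Grimmett, *The Random-Cluster Model*, Springer 2006 (`book:grimmett2006-random-cluster-model`): Lemma (4.14)(b), §4.5,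
  proof of Thm. (4.63), (4.72)–(4.76) [PDF pp. 74, 89–92]; Conj. (5.34)(ii). [Grimmett2006]
* M. Aizenman, H. Duminil-Copin, V. Sidoravicius, Comm. Math. Phys. 334 (2015) 719–742, Thm. 1.2, Cor. 1.5(1).
  [AizenmanDuminilCopinSidoraviciusCMP2015]
-/

noncomputable section

open MeasureTheory Set Filter Finset
open scoped Topology ENNReal

namespace Summit.CriticalPhenomena.PercolationContinuityZ3.Theorems.FK

open Literature.Probability.Percolation Literature.Probability.LatticeModels
open Literature.Barriers.CriticalPhenomena

variable {d : ℕ} {p q : ℝ}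

/-! ### The edge density for every boundary wiring (Grimmett 2006, (4.74)–(4.76)) -/

section EdgeDensity

/-- Termwise sandwich, lower half: `∑_{e ∈ E_{Λ_N}} φ⁰_{Λ_N}(J_e) ≤ ∑_{e ∈ E_{Λ_N}} φ^B_{Λ_N}(J_e)` for every wired class `B`.
[cite: Grimmett2006, proof of Thm. (4.63), (4.75)] -/
theorem sum_boxFreeEdgeProb_le_sum_rcMeasure_real_eOpen (hp : p ∈ Set.Icc (0 : ℝ) 1) (hq : 1 ≤ q) {N : ℕ}
    (B : Set ↥(box d N)) :
    ∑ e ∈ edgesIn (zdGraph d) (box d N), boxFreeEdgeProb d p q e N ≤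
      ∑ e ∈ edgesIn (zdGraph d) (box d N), (rcMeasure (finsetGraph (zdGraph d) (box d N)) p q B).real (eOpen (box d N) e) :=
  Finset.sum_le_sum fun e _ =>
    rcMeasure_real_mono_wired_of_isUpperSet _ hp hq (Set.empty_subset _) (isUpperSet_eOpen _ e)

/-- Termwise sandwich, upper half: `∑_{e ∈ E_{Λ_N}} φ^B_{Λ_N}(J_e) ≤ ∑_{e ∈ E_{Λ_N}} φ¹_{Λ_N}(J_e)` for `B ⊆ ∂Λ_N`.
[cite: Grimmett2006, proof of Thm. (4.63), (4.75)] -/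
theorem sum_rcMeasure_real_eOpen_le_sum_boxWiredEdgeProb (hp : p ∈ Set.Icc (0 : ℝ) 1) (hq : 1 ≤ q) {N : ℕ}
    {B : Set ↥(box d N)} (hB : B ⊆ boxBC d true N) :
    ∑ e ∈ edgesIn (zdGraph d) (box d N), (rcMeasure (finsetGraph (zdGraph d) (box d N)) p q B).real (eOpen (box d N) e) ≤
      ∑ e ∈ edgesIn (zdGraph d) (box d N), boxWiredEdgeProb d p q e N :=
  Finset.sum_le_sum fun e _ => rcMeasure_real_mono_wired_of_isUpperSet _ hp hq hB (isUpperSet_eOpen _ e)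

/-- `E^B_{Λ_N,p,q}|ω| / |Λ_N|` written with the ambient edge probabilities. [cite: Grimmett2006, proof of Thm. (4.63), (4.73)] -/
theorem rcExpect_card_div_card_box_eq (hp : p ∈ Set.Icc (0 : ℝ) 1) (hq : 0 < q) {N : ℕ} (B : Set ↥(box d N)) :
    rcExpect (finsetGraph (zdGraph d) (box d N)) p q B (fun ω => (#ω : ℝ)) / #(box d N) =
      (∑ e ∈ edgesIn (zdGraph d) (box d N), (rcMeasure (finsetGraph (zdGraph d) (box d N)) p q B).real (eOpen (box d N) e)) /
        #(box d N) := by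
  rw [rcExpect_card_eq_sum_edgesIn hp hq]

/-- **Mean edge density, lower semilimit**: `d · h⁰(p,q) ≤ liminf_N |Λ_N|⁻¹ E^{B_N}_{Λ_N,p,q}|ω|` for every sequence of
wired classes `B_N` (`0 ≤ p ≤ 1`, `q ≥ 1`, `e₀` any lattice edge). [cite: Grimmett2006, proof of Thm. (4.63), (4.74)–(4.76)] -/
theorem le_liminf_rcExpect_card_div_card_box (hp : p ∈ Set.Icc (0 : ℝ) 1) (hq : 1 ≤ q) {e₀ : Sym2 (Site d)}
    (he₀ : e₀ ∈ (zdGraph d).edgeSet) (B : ∀ N : ℕ, Set ↥(box d N)) :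
    d * freeEdgeDensity d p q e₀ ≤
      liminf (fun N => rcExpect (finsetGraph (zdGraph d) (box d N)) p q (B N) (fun ω => (#ω : ℝ)) / #(box d N)) atTop := by
  have hq0 : 0 < q := one_pos.trans_le hq
  rw [← (tendsto_sum_boxFreeEdgeProb_div_card_box hp hq he₀).liminf_eq]
  refine liminf_le_liminf (Eventually.of_forall fun N => ?_) ?_ ?_
  · rw [rcExpect_card_div_card_box_eq hp hq0]
    exact div_le_div_of_nonneg_right (sum_boxFreeEdgeProb_le_sum_rcMeasure_real_eOpen hp hq (B N)) (Nat.cast_nonneg _)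
  · exact isBoundedUnder_of ⟨0, fun N => div_nonneg (Finset.sum_nonneg fun e _ => freeEdgeProb_nonneg _ _ _ _) (Nat.cast_nonneg _)⟩
  · refine (isBoundedUnder_of ⟨(d : ℝ), fun N => ?_⟩).isCoboundedUnder_ge
    rw [rcExpect_card_div_card_box_eq hp hq0]
    have hpos : (0 : ℝ) < #(box d N) := by exact_mod_cast Finset.card_pos.2 (box_nonempty d N)
    rw [div_le_iff₀ hpos]
    haveI := isProbabilityMeasure_rcMeasure (finsetGraph (zdGraph d) (box d N)) hp hq0 (B N)
    calc ∑ e ∈ edgesIn (zdGraph d) (box d N), (rcMeasure (finsetGraph (zdGraph d) (box d N)) p q (B N)).real (eOpen (box d N) e)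
        ≤ ∑ e ∈ edgesIn (zdGraph d) (box d N), (1 : ℝ) := Finset.sum_le_sum fun e _ => measureReal_le_one
      _ = #(edgesIn (zdGraph d) (box d N)) := by rw [Finset.sum_const, nsmul_eq_mul, mul_one]
      _ ≤ d * #(box d N) := by exact_mod_cast card_edgesIn_le_mul_card (box d N)

/-- **Mean edge density, upper semilimit**: `limsup_N |Λ_N|⁻¹ E^{B_N}_{Λ_N,p,q}|ω| ≤ d · h¹(p,q)` for every sequence of
wired classes `B_N ⊆ ∂Λ_N`. [cite: Grimmett2006, proof of Thm. (4.63), (4.74)–(4.76)] -/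
theorem limsup_rcExpect_card_div_card_box_le (hp : p ∈ Set.Icc (0 : ℝ) 1) (hq : 1 ≤ q) {e₀ : Sym2 (Site d)}
    (he₀ : e₀ ∈ (zdGraph d).edgeSet) {B : ∀ N : ℕ, Set ↥(box d N)} (hB : ∀ N, B N ⊆ boxBC d true N) :
    limsup (fun N => rcExpect (finsetGraph (zdGraph d) (box d N)) p q (B N) (fun ω => (#ω : ℝ)) / #(box d N)) atTop ≤
      d * wiredEdgeDensity d p q e₀ := by
  have hq0 : 0 < q := one_pos.trans_le hq
  rw [← (tendsto_sum_boxWiredEdgeProb_div_card_box hp hq he₀).limsup_eq]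
  refine limsup_le_limsup (Eventually.of_forall fun N => ?_) ?_ ?_
  · dsimp only
    rw [rcExpect_card_div_card_box_eq hp hq0]
    exact div_le_div_of_nonneg_right (sum_rcMeasure_real_eOpen_le_sum_boxWiredEdgeProb hp hq (hB N)) (Nat.cast_nonneg _)
  · refine (isBoundedUnder_of ⟨(0 : ℝ), fun N => ?_⟩).isCoboundedUnder_le
    rw [rcExpect_card_div_card_box_eq hp hq0]
    exact div_nonneg (Finset.sum_nonneg fun e _ => measureReal_nonneg) (Nat.cast_nonneg _)
  · refine isBoundedUnder_of ⟨(d : ℝ), fun N => ?_⟩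
    have hpos : (0 : ℝ) < #(box d N) := by exact_mod_cast Finset.card_pos.2 (box_nonempty d N)
    rw [div_le_iff₀ hpos]
    haveI := isProbabilityMeasure_rcMeasure (finsetGraph (zdGraph d) (box d N)) hp hq0
      (wiredBoundary (zdGraph d) (box d N))
    calc ∑ e ∈ edgesIn (zdGraph d) (box d N), boxWiredEdgeProb d p q e N
        ≤ ∑ e ∈ edgesIn (zdGraph d) (box d N), (1 : ℝ) := Finset.sum_le_sum fun e _ => measureReal_le_one
      _ = #(edgesIn (zdGraph d) (box d N)) := by rw [Finset.sum_const, nsmul_eq_mul, mul_one]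
      _ ≤ d * #(box d N) := by exact_mod_cast card_edgesIn_le_mul_card (box d N)

/-- **Grimmett's (4.74)–(4.76) for every boundary wiring**: if `h⁰(p,q) = h¹(p,q)` (`p ∉ 𝒟_q`, Thm. (4.63)), then the mean
number of open edges per site converges, `|Λ_N|⁻¹ E^{B_N}_{Λ_N,p,q}|ω| → d · h(p,q)`, along EVERY sequence of wired classes
`B_N ⊆ ∂Λ_N` (`0 ≤ p ≤ 1`, `q ≥ 1`). [cite: Grimmett2006, proof of Thm. (4.63), (4.74)–(4.76)] -/
theorem tendsto_rcExpect_card_div_card_box_of_edgeDensity_eq (hp : p ∈ Set.Icc (0 : ℝ) 1) (hq : 1 ≤ q)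
    {e₀ : Sym2 (Site d)} (he₀ : e₀ ∈ (zdGraph d).edgeSet) {B : ∀ N : ℕ, Set ↥(box d N)} (hB : ∀ N, B N ⊆ boxBC d true N)
    (h : freeEdgeDensity d p q e₀ = wiredEdgeDensity d p q e₀) :
    Tendsto (fun N => rcExpect (finsetGraph (zdGraph d) (box d N)) p q (B N) (fun ω => (#ω : ℝ)) / #(box d N)) atTop
      (𝓝 (d * freeEdgeDensity d p q e₀)) := by
  have hq0 : 0 < q := one_pos.trans_le hq
  have h₀ := tendsto_sum_boxFreeEdgeProb_div_card_box hp hq he₀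
  have h₁ := tendsto_sum_boxWiredEdgeProb_div_card_box hp hq he₀
  rw [← h] at h₁
  refine tendsto_of_tendsto_of_tendsto_of_le_of_le h₀ h₁ (fun N => ?_) (fun N => ?_)
  · dsimp only
    rw [rcExpect_card_div_card_box_eq hp hq0 (B N)]
    exact div_le_div_of_nonneg_right (sum_boxFreeEdgeProb_le_sum_rcMeasure_real_eOpen hp hq (B N)) (Nat.cast_nonneg _)
  · dsimp only
    rw [rcExpect_card_div_card_box_eq hp hq0 (B N)]
    exact div_le_div_of_nonneg_right (sum_rcMeasure_real_eOpen_le_sum_boxWiredEdgeProb hp hq (hB N)) (Nat.cast_nonneg _)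

/-- The same under uniqueness `φ⁰_{p,q} = φ¹_{p,q}` (`⟺ h⁰ = h¹`, Thm. (4.63), `FreeWiredCoincidence`).
[cite: Grimmett2006, Thm. (4.63) with (4.74)–(4.76)] -/
theorem tendsto_rcExpect_card_div_card_box_of_rcLimit_eq (hp : p ∈ Set.Icc (0 : ℝ) 1) (hq : 1 ≤ q)
    {e₀ : Sym2 (Site d)} (he₀ : e₀ ∈ (zdGraph d).edgeSet) {B : ∀ N : ℕ, Set ↥(box d N)} (hB : ∀ N, B N ⊆ boxBC d true N)
    (huniq : rcLimit d false p q = rcLimit d true p q) :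
    Tendsto (fun N => rcExpect (finsetGraph (zdGraph d) (box d N)) p q (B N) (fun ω => (#ω : ℝ)) / #(box d N)) atTop
      (𝓝 (d * freeEdgeDensity d p q e₀)) :=
  tendsto_rcExpect_card_div_card_box_of_edgeDensity_eq hp hq he₀ hB
    (edgeDensity_eq_of_rcLimit_false_eq_rcLimit_true hp hq huniq he₀)

/-- **Critical FK–Ising model, `d ≥ 3`**: the mean number of open edges per site of the critical finite-volume FK–Ising
measures converges to `d · h(p_c(2), 2)` WHATEVER the boundary wirings `B_N ⊆ ∂Λ_N` — no latent heat and no boundary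
sensitivity of the energy density at `β_c` (`h⁰(p_c(2),2) = h¹(p_c(2),2)`, `UniquenessCriticalFKIsing`, from ADS 2015).
[cite: Grimmett2006, Thm. (4.63) with (4.74)–(4.76) and Conj. (5.34)(ii) at q = 2] [cite: AizenmanDuminilCopinSidoraviciusCMP2015, Thm. 1.2 with Cor. 1.5 (1)] -/
theorem tendsto_rcExpect_card_div_card_box_rcCriticalProb_two (hd : 3 ≤ d) {e₀ : Sym2 (Site d)}
    (he₀ : e₀ ∈ (zdGraph d).edgeSet) {B : ∀ N : ℕ, Set ↥(box d N)} (hB : ∀ N, B N ⊆ boxBC d true N) :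
    Tendsto (fun N => rcExpect (finsetGraph (zdGraph d) (box d N)) (rcCriticalProb d 2) 2 (B N) (fun ω => (#ω : ℝ)) /
      #(box d N)) atTop (𝓝 (d * freeEdgeDensity d (rcCriticalProb d 2) 2 e₀)) :=
  tendsto_rcExpect_card_div_card_box_of_edgeDensity_eq (rcCriticalProb_mem_Icc d 2) (by norm_num) he₀ hB
    (freeEdgeDensity_eq_wiredEdgeDensity_rcCriticalProb_two hd he₀)

end EdgeDensity

end Summit.CriticalPhenomena.PercolationContinuityZ3.Theorems.FK

end
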